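import Summits.Ventures.CertifiedArithmetic.LowPrec.GemmEnvelopeScaled
import Summits.Ventures.CertifiedArithmetic.LowPrec.AccumulateTwoLevel
import Summits.Ventures.CertifiedArithmetic.LowPrec.MXGemm

/-!
# GEMM-level envelopes, part (g): E-DEC assembled with the landed accumulation theorems (LXX-g)

HONEST FRAMING: certified error envelopes and provably optimal rounding/accumulation schemes for
low-precision formats under stated cost models; every table by two implementations; no hardware or
vendor claims.

The accumulation line `γ` of E-DEC (`GemmEnvelopeDecomposition`, `GemmEnvelopeScaled`) instantiated by
the kernel's accumulation theorems, giving END-TO-END certified envelopes with explicit numbers: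

* `gemm_mxCeil_E4M3_twoLevel_Binary32` — MX-E4M3 (ceil scale) operands on `C_blk(κ)`, `κ ≤ 14336`,
  products exact, TWO-LEVEL `binary32` accumulation (any blockwise summation trees `ts` inside the
  `B` blocks of length `≤ k`, any outer tree `T` over the block results; `AccumulateTwoLevel`):
  `|ŝ − Σ a b| ≤ (35/289 + γ₂ · 324/289) · Σ|a b|`,
  `γ₂ = (k−1)/16777217 + (B−1)/16777217 · (1 + (k−1)/16777217)`  (`1/16777217 = u₃₂/(1+u₃₂)`).
* `gemm_vec_E4M3_anyOrder_Binary32` — per-vector E4M3 operands (covering numerators, `κ ≤ 28672`),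
  unscaled element products (binary32 values) accumulated in `binary32` in ANY order (Jeannerod–Rump,
  `MXGemm.abs_eval_Binary32_sub_exact_le`), scales applied exactly in the epilogue:
  `|s_a s_b ŝ − Σ a b| ≤ (35/289 + (n−1)/16777217 · 324/289) · Σ|a b|`, `n` = number of leaves.

The tree data are hypotheses relating the leaves to the products (honest: any summation order).
For `k = 32`, `B = 256` (`K = 8192`): `γ₂ ≈ 1.7 · 10⁻⁵`, shift `324/289 · γ₂ ≈ 1.9 · 10⁻⁵` against
`35/289 ≈ 0.1211`; the two-implementation certificate `certs/gemm/GEMM-ENVELOPES-ACC.json` measures the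
actual accumulation contribution on the witnesses (0 on W1–W5, ≤ 3.5 · 10⁻⁷ on generic inputs).
[cite: BlanchardHighamLopezMaryPranesh2020, §3]; [cite: JeannerodRump2018, Thm 4.1];
[cite: RouhaniEtAl2023MX, §5.1]; [cite: MicikeviciusEtAl2022, §3]
-/

namespace Summit.Ventures.CertifiedArithmetic.LowPrec.GemmEnvelope

open Finset
open Literature.ComputerArithmetic.FloatingPoint
open Literature.ComputerArithmetic.FloatingPoint.Format
open Literature.ComputerArithmetic.FloatingPoint.MiniFloat
open Literature.ComputerArithmetic.FloatingPoint.MXBlock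
open Literature.ComputerArithmetic.JeannerodRump2018
open Literature.ComputerArithmetic.JeannerodRump2018.SumTree
open Summit.Ventures.CertifiedArithmetic.LowPrec.SR

/-- **MX-E4M3 GEMM, END TO END (two-level binary32 accumulation).**  Operands quantised by the ceil-scaled
MX-E4M3 datapath on `C_blk(κ)`, `κ ≤ 14336`; inside each of the `B` blocks the (exact) products are summed
in `binary32` along any tree with at most `k` leaves, the block results along any outer tree, all nodes in
range.  Then `|ŝ − Σ a b| ≤ (35/289 + γ₂·324/289)·Σ|a b|`.
[cite: BlanchardHighamLopezMaryPranesh2020, §3]; [cite: RouhaniEtAl2023MX, §5.1] -/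
theorem gemm_mxCeil_E4M3_twoLevel_Binary32 {B k : ℕ} (hB : 1 ≤ B) (hk : 1 ≤ k)
    (a b : Fin B → Fin k → ℚ) {κ : ℚ} (hκ : κ ≤ 14336)
    (hca : ∀ j i, a j i = 0 ∨ blockMax (a j) ≤ κ * |a j i|)
    (hcb : ∀ j i, b j i = 0 ∨ blockMax (b j) ≤ κ * |b j i|)
    (ts : List SumTree) (T : SumTree)
    (hexact : (ts.map SumTree.exact).sum =
      ∑ j, ∑ i, (ceilScale E4M3 (a j) * (roundNE E4M3 (a j i / ceilScale E4M3 (a j))).toRat) *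
        (ceilScale E4M3 (b j) * (roundNE E4M3 (b j i / ceilScale E4M3 (b j))).toRat))
    (habs : (ts.map absSum).sum =
      ∑ j, ∑ i, |(ceilScale E4M3 (a j) * (roundNE E4M3 (a j i / ceilScale E4M3 (a j))).toRat) *
        (ceilScale E4M3 (b j) * (roundNE E4M3 (b j i / ceilScale E4M3 (b j))).toRat)|)
    (hlen : ts.length = B)
    (hT : T.leaves = ts.map (SumTree.eval (flα Format.Binary32)))
    (hinner : ∀ t ∈ ts, TreeInRange Format.Binary32 t) (hK : ∀ t ∈ ts, t.leaves.length ≤ k)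
    (houter : TreeInRange Format.Binary32 T) :
    |SumTree.eval (flα Format.Binary32) T - ∑ j, ∑ i, a j i * b j i|
      ≤ (35 / 289 + (((k : ℚ) - 1) / 16777217
          + ((B : ℚ) - 1) / 16777217 * (1 + ((k : ℚ) - 1) / 16777217)) * (324 / 289))
        * ∑ j, ∑ i, |a j i * b j i| := by
  have hacc := abs_twoLevel_sub_exact_le (α := Format.Binary32) (β := Format.Binary32)
    (by decide) (by decide) ts T k hT hinner hK houter
  rw [hexact, habs, hlen, Binary32_sharp_unit] at hacc
  have hk' : (1 : ℚ) ≤ k := by exact_mod_cast hk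
  have hB' : (1 : ℚ) ≤ B := by exact_mod_cast hB
  have hγ0 : (0 : ℚ) ≤ ((k : ℚ) - 1) * (1 / 16777217)
      + ((B : ℚ) - 1) * (1 / 16777217) * (1 + ((k : ℚ) - 1) * (1 / 16777217)) := by
    have h1 : (0 : ℚ) ≤ (k : ℚ) - 1 := by linarith
    have h2 : (0 : ℚ) ≤ (B : ℚ) - 1 := by linarith
    positivity
  have h := gemm_mxCeil_envelope_E4M3 a b _ _ (δ := 0)
    (acc := SumTree.eval (flα Format.Binary32) T) (c := SumTree.eval (flα Format.Binary32) T)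
    hγ0 le_rfl hκ hca hcb (fun _ _ => rfl) (fun _ _ => rfl) hacc (by simp)
  refine le_trans h (le_of_eq ?_)
  ring

/-- **Per-vector E4M3 GEMM, END TO END (binary32 accumulation in any order, exact epilogue).**  Operands
quantised by the per-vector E4M3 datapath with covering numerators `Aa, Ab` on `C_row(κ)`, `κ ≤ 28672`; the
unscaled element products `fl(aᵢ/s_a)·fl(bᵢ/s_b)` (values of `binary32`, the leaves of any summation tree
`T`, `n` leaves, `(1 + (n−1)u')·Σ|leaves| ≤ maxRat₃₂`) are accumulated in `binary32`; the scales are applied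
exactly.  Then `|s_a s_b ŝ − Σ a b| ≤ (35/289 + (n−1)/16777217 · 324/289)·Σ|a b|`.
[cite: JeannerodRump2018, Thm 4.1]; [cite: MicikeviciusEtAl2022, §3] -/
theorem gemm_vec_E4M3_anyOrder_Binary32 {ι : Type*} [Fintype ι] (a b : ι → ℚ) {Aa Ab κ : ℚ}
    (hκ : κ ≤ 28672) (hAa : ∀ i, |a i| ≤ Aa) (hAb : ∀ i, |b i| ≤ Ab)
    (hca : ∀ i, a i = 0 ∨ Aa ≤ κ * |a i|) (hcb : ∀ i, b i = 0 ∨ Ab ≤ κ * |b i|)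
    (T : SumTree)
    (hexact : SumTree.exact T = ∑ i, (roundNE E4M3 (a i / (Aa / E4M3.maxRat))).toRat *
      (roundNE E4M3 (b i / (Ab / E4M3.maxRat))).toRat)
    (habs : absSum T = ∑ i, |(roundNE E4M3 (a i / (Aa / E4M3.maxRat))).toRat *
      (roundNE E4M3 (b i / (Ab / E4M3.maxRat))).toRat|)
    (hT : ∀ x ∈ T.leaves, ∃ z : MiniFloat Format.Binary32, z.toRat = x)
    (hS : (1 + ((T.leaves.length : ℚ) - 1)
        * (Format.Binary32.unitRoundoff / (1 + Format.Binary32.unitRoundoff))) * absSum T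
      ≤ Format.Binary32.maxRat) :
    |Aa / E4M3.maxRat * (Ab / E4M3.maxRat) * SumTree.eval (flα Format.Binary32) T - ∑ i, a i * b i|
      ≤ (35 / 289 + ((T.leaves.length : ℚ) - 1) / 16777217 * (324 / 289)) * ∑ i, |a i * b i| := by
  set sa := Aa / E4M3.maxRat with hsa
  set sb := Ab / E4M3.maxRat with hsb
  have hJR := abs_eval_Binary32_sub_exact_le T hT hS
  rw [Binary32_sharp_unit, habs, hexact] at hJR
  have hn : (0 : ℚ) ≤ (T.leaves.length : ℚ) - 1 := by
    have := one_le_length_leaves T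
    have h' : (1 : ℚ) ≤ (T.leaves.length : ℚ) := by exact_mod_cast this
    linarith
  have hγ0 : (0 : ℚ) ≤ ((T.leaves.length : ℚ) - 1) * (1 / 16777217) := by positivity
  have e1 : ∑ i, (sa * (roundNE E4M3 (a i / sa)).toRat) * (sb * (roundNE E4M3 (b i / sb)).toRat)
      = sa * sb * ∑ i, (roundNE E4M3 (a i / sa)).toRat * (roundNE E4M3 (b i / sb)).toRat := by
    rw [Finset.mul_sum]; exact Finset.sum_congr rfl fun i _ => by ring
  have e2 : ∑ i, |(sa * (roundNE E4M3 (a i / sa)).toRat) * (sb * (roundNE E4M3 (b i / sb)).toRat)|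
      = |sa * sb| * ∑ i, |(roundNE E4M3 (a i / sa)).toRat * (roundNE E4M3 (b i / sb)).toRat| := by
    rw [Finset.mul_sum]
    exact Finset.sum_congr rfl fun i _ => by rw [← abs_mul]; ring_nf
  have hacc : |sa * sb * SumTree.eval (flα Format.Binary32) T
        - ∑ i, (sa * (roundNE E4M3 (a i / sa)).toRat) * (sb * (roundNE E4M3 (b i / sb)).toRat)|
      ≤ ((T.leaves.length : ℚ) - 1) * (1 / 16777217)
        * ∑ i, |(sa * (roundNE E4M3 (a i / sa)).toRat) * (sb * (roundNE E4M3 (b i / sb)).toRat)| := by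
    rw [e1, e2, ← mul_sub, abs_mul]
    refine le_trans (mul_le_mul_of_nonneg_left hJR (abs_nonneg (sa * sb))) (le_of_eq ?_)
    ring
  have h := gemm_vec_envelope_E4M3 a b (fun i => sa * (roundNE E4M3 (a i / sa)).toRat)
    (fun i => sb * (roundNE E4M3 (b i / sb)).toRat) (δ := 0)
    (acc := sa * sb * SumTree.eval (flα Format.Binary32) T)
    (c := sa * sb * SumTree.eval (flα Format.Binary32) T)
    hγ0 le_rfl hκ hAa hAb hca hcb (fun _ => rfl) (fun _ => rfl) hacc (by simp)
  refine le_trans h (le_of_eq ?_)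
  ring

end Summit.Ventures.CertifiedArithmetic.LowPrec.GemmEnvelope
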